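import Mathlib
import HarnessLib
import Summits.QuantumFields.YangMills.Theses.ScalingWindowSplit
import Summits.QuantumFields.YangMills.Theorems.ScalingWindowSplitExistenceLegFromLattice

/-!
# `SelfNormalisedMomentBoundsR` (stmt-QuantumFields-18014) — small-model fact: the FLOOR excludes the trivial group

Refuter's birth vetting of crux U_R = `ScalingWindowSplit.SelfNormalisedMomentBoundsR`.  The statement is
"group-blind" (∀ compact `G`); this file kernel-certifies the first line of its junk analysis: on a
SUBSINGLETON gauge group every truncated lattice two-point function of the curvature vanishes identically
(`trunc_eq_zero_of_subsingleton`), so the polynomial floor `a_k ^ p ≤ T⁰_k(u, θu)` of U_R (and of W₁, W₂) fails at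
EVERY `k` (`floor_false_of_subsingleton`) and the floor-and-window hypothesis of U_R is unsatisfiable there
(`floorWindow_false_of_subsingleton`): U_R holds VACUOUSLY at `G = PUnit`, it is not closed by the junk model and
not refuted by it.  No positive instance of a Theses decl is asserted.  No `sorry`; axioms `propext`,
`Classical.choice`, `Quot.sound`.
-/

noncomputable section

open scoped SchwartzMap BigOperators Topology
open MeasureTheory ProbabilityTheory Filter Topology
open Literature.MathematicalPhysics.AQFT Literature.MathematicalPhysics.QuantumLattice
open Literature.MathematicalPhysics.QuantumFieldTheory
open Summit.QuantumFields.YangMills.Theorems.ScalingWindowSplit (trunc_eq_covariance)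

namespace Summit.QuantumFields.YangMills.Theorems.SelfNormalisedMomentBoundsR.Negative

variable {G : Type} [Group G] [TopologicalSpace G] [IsTopologicalGroup G] [CompactSpace G]
  [MeasurableSpace G] [BorelSpace G]

/-- **Trivial group ⇒ no truncated two-point function.**  If `G` is a subsingleton, every configuration space
`GaugeConfig 4 S G` is a subsingleton, the smeared curvature field is a constant random variable under Wilson's
(probability) measure, and the truncated lattice two-point function of ANY scheme vanishes at every `k`.
[folklore] -/
theorem trunc_eq_zero_of_subsingleton [Subsingleton G] (r : LatticeRep G)
    (S : SpeciesScheme (YMSpecies G)) (k : ℕ) (f g : 𝓢(EuclideanSpace ℝ (Fin 4), ℝ)) :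
    latticeSchwinger r.ρ S (fun s => s.F) k (1 + 1) (fun _ => r.curvature) ![f, g] -
        latticeSchwinger r.ρ S (fun s => s.F) k 1 (fun _ => r.curvature) ![f] *
          latticeSchwinger r.ρ S (fun s => s.F) k 1 (fun _ => r.curvature) ![g] = 0 := by
  rw [trunc_eq_covariance]
  haveI := isProbabilityMeasure_wilsonMeasure (d := 4) (L := S.side k) r.ρ r.continuous (S.β k)
  set U₀ : GaugeConfig 4 (S.side k) G := fun _ => 1 with hU₀
  have hconst : (fun U : GaugeConfig 4 (S.side k) G =>
      smearedLatticeField r.curvature.F (Literature.Probability.LatticeModels.box 4 (S.L k)) (S.a k)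
        (S.c r.curvature k) (S.m r.curvature k) f (torusLift (S.side k) U)) =
      fun _ => smearedLatticeField r.curvature.F (Literature.Probability.LatticeModels.box 4 (S.L k)) (S.a k)
        (S.c r.curvature k) (S.m r.curvature k) f (torusLift (S.side k) U₀) := by
    funext U
    rw [Subsingleton.elim U U₀]
  rw [hconst]
  exact covariance_const_left _

/-- **The polynomial floor fails on the trivial group, at every `k`.**  With `bare` the bare scheme of `sch`
(`c ≡ 1`, `m ≡ 0`) and `T w k` the bare truncated two-point function at the reflected pair `(w, θw)` — the `let`s of
U_R verbatim — one has `¬ (sch.a k ^ p ≤ T u k)` for a subsingleton `G`, since `T u k = 0 < sch.a k ^ p`.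
[folklore] -/
theorem floor_false_of_subsingleton [Subsingleton G] (r : LatticeRep G)
    (sch : SpeciesScheme (YMSpecies G)) (u : 𝓢(EuclideanSpace ℝ (Fin 4), ℝ)) (p k : ℕ) :
    let bare : SpeciesScheme (YMSpecies G) := { sch with c := fun _ _ => 1, m := fun _ _ => 0 }
    let T : 𝓢(EuclideanSpace ℝ (Fin 4), ℝ) → ℕ → ℝ := fun w k =>
      latticeSchwinger r.ρ bare (fun s => s.F) k (1 + 1) (fun _ => r.curvature) ![w, thetaTest 4 w] -
        latticeSchwinger r.ρ bare (fun s => s.F) k 1 (fun _ => r.curvature) ![w] *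
          latticeSchwinger r.ρ bare (fun s => s.F) k 1 (fun _ => r.curvature) ![thetaTest 4 w]
    ¬ (sch.a k ^ p ≤ T u k) := by
  intro bare T h
  have h0 : T u k = 0 := trunc_eq_zero_of_subsingleton r bare k u (thetaTest 4 u)
  exact absurd (h0 ▸ h) (not_le.2 (pow_pos (sch.a_pos k) p))

/-- **U_R is vacuous on the trivial group.**  The floor-and-window hypothesis of `SelfNormalisedMomentBoundsR`
(`∀ᶠ k, a_k ^ p ≤ T⁰_k(u,θu) ∧ T⁰_k(u,θu) ≤ M · T⁰_k(τ₋₁u, θτ₋₁u)`) is unsatisfiable for a subsingleton `G`, for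
every `r, sch, u, p, M`: the junk model `G = PUnit` (constant curvature, `T⁰ ≡ 0`) is excluded by the floor, as the
route's junk analysis asserts; U_R says nothing there and is neither closed nor refuted by it. [folklore] -/
theorem floorWindow_false_of_subsingleton [Subsingleton G] (r : LatticeRep G)
    (sch : SpeciesScheme (YMSpecies G)) (u : 𝓢(EuclideanSpace ℝ (Fin 4), ℝ)) (p : ℕ) (M : ℝ) :
    let bare : SpeciesScheme (YMSpecies G) := { sch with c := fun _ _ => 1, m := fun _ _ => 0 }
    let T : 𝓢(EuclideanSpace ℝ (Fin 4), ℝ) → ℕ → ℝ := fun w k =>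
      latticeSchwinger r.ρ bare (fun s => s.F) k (1 + 1) (fun _ => r.curvature) ![w, thetaTest 4 w] -
        latticeSchwinger r.ρ bare (fun s => s.F) k 1 (fun _ => r.curvature) ![w] *
          latticeSchwinger r.ρ bare (fun s => s.F) k 1 (fun _ => r.curvature) ![thetaTest 4 w]
    ¬ (∀ᶠ k in Filter.atTop, sch.a k ^ p ≤ T u k ∧ T u k ≤ M * T (timeShiftTest 4 (-1) u) k) := by
  intro bare T h
  obtain ⟨k, hk⟩ := h.exists
  exact floor_false_of_subsingleton r sch u p k hk.1

end Summit.QuantumFields.YangMills.Theorems.SelfNormalisedMomentBoundsR.Negative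

end
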